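import Summits.NavierStokesRegularity.NavierStokesRegularity.Theorems.ExtremiserTransienceTypeIAncientAxiallyPeriodicLiouville
import HarnessLib

/-!
# Route `ExtremiserTransience`, crux `NearExtremalTransiencePerFlow` (stmt-NavierStokesRegularity-26567), LINE g9-β
# `filament_selection` — the OFFERED RUNG R1 `PeriodicFilamentLiouville` («periodic filaments are dead»), PROVED

Theorems file (`--supports stmt-NavierStokesRegularity-26567`).  `periodicFilamentLiouville` is VERBATIM the Prop
`PeriodicFilamentLiouville` of the crux workfile `Cruxes/NearExtremalTransiencePerFlow/Lines/filament_selection.lean`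
(ideator ns-idea-5 g9, rev 3, §2d) with its vocabulary unfolded (`IsX3Periodic ℓ w := ∀ x, w (x + ℓ • e₃) = w x`,
which is letter for letter the tree's `IsAxiallyPeriodic`; `HasLinGrowth A w := ∀ x R, 0 < R → ∫_{B(x,R)}‖w‖² ≤ A R`),
so that `theorem rung_periodicFilamentLiouville : PeriodicFilamentLiouville := periodicFilamentLiouville` closes in the
workfile by definitional unfolding:

  an `x₃`-periodic Type-I ancient mild field (Oseen gauge) all of whose slices have linear local-energy growth
  is identically zero.

It is the special case «with growth hypothesis» of the STRONGER theorem
`AxiallyPeriodicLiouville.eq_zero_of_isTypeIAncientMild_of_isAxiallyPeriodic`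
(`ExtremiserTransienceTypeIAncientAxiallyPeriodicLiouville`): the linear-growth hypothesis is NOT needed — every
axially periodic Type-I ancient mild solution vanishes (L^∞ mild contraction of the axial oscillation backward in
time + the tree's line-invariant KNSS Liouville theorem + forward uniqueness).  Consequently the `x₃`-periodic
sub-case of the line's heart H `NoFilamentTubeSlice` holds (the zero field is not a tube slice; the workfile's
`not_isTubeSlice_periodic_of_rung`), and more: NO `x₃`-periodic Type-I ancient mild field is a candidate limit
object at all.  HONEST FRAMING: a Liouville theorem about hypothetical blow-up profiles; crux 26567, H, and
Navier–Stokes regularity remain OPEN; no summit is proved by a line. [folklore]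
-/

noncomputable section

open MeasureTheory Set Metric
open Literature.Analysis.FluidPDE

namespace Summit.NavierStokesRegularity.NavierStokesRegularity.Theorems.NearExtremalTransiencePerFlow.FilamentSelection
-- the summit's namespace `Summit.NavierStokesRegularity.NavierStokesRegularity` repeats the problem name by convention (D-0017)
set_option linter.dupNamespace false

/-- **Rung R1 `PeriodicFilamentLiouville` of LINE g9-β, EXACTLY as offered** (workfile §2d, `IsX3Periodic` and
`HasLinGrowth` unfolded): for every `K A ℓ` and every Type-I ancient mild field `W` (Oseen gauge, constant `K`)
with `0 < ℓ`, axially `ℓ`-periodic slices and slices of linear local-energy growth `A`, `W(τ, x) = 0` for all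
`τ < 0` and all `x`.  Immediate from `AxiallyPeriodicLiouville.eq_zero_of_isTypeIAncientMild_of_isAxiallyPeriodic`,
which does not use the growth hypothesis. [folklore] -/
theorem periodicFilamentLiouville :
    ∀ (K A ℓ : ℝ) (W : ℝ → EuclideanSpace ℝ (Fin 3) → EuclideanSpace ℝ (Fin 3)),
    Literature.Analysis.FluidPDE.IsTypeIAncientMild K W → 0 < ℓ →
    (∀ τ < 0, ∀ x, W τ (x + ℓ • EuclideanSpace.single (2 : Fin 3) (1 : ℝ)) = W τ x) →
    (∀ τ < 0, ∀ (x : EuclideanSpace ℝ (Fin 3)) (R : ℝ), 0 < R →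
      ∫ z in Metric.ball x R, ‖W τ z‖ ^ 2 ≤ A * R) →
    ∀ τ < 0, ∀ x, W τ x = 0 :=
  fun _ _ _ _ hW hℓ hper _ => AxiallyPeriodicLiouville.eq_zero_of_isTypeIAncientMild_of_isAxiallyPeriodic hW hℓ hper

/-- The growth-free form, restated next to the rung for H-hands: every axially `ℓ`-periodic Type-I ancient mild
field is identically zero (no local-energy hypothesis). [folklore] -/
theorem eq_zero_of_isX3Periodic {K ℓ : ℝ} {W : ℝ → EuclideanSpace ℝ (Fin 3) → EuclideanSpace ℝ (Fin 3)}
    (hW : Literature.Analysis.FluidPDE.IsTypeIAncientMild K W) (hℓ : 0 < ℓ)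
    (hper : ∀ τ < 0, ∀ x, W τ (x + ℓ • EuclideanSpace.single (2 : Fin 3) (1 : ℝ)) = W τ x) :
    ∀ τ < 0, ∀ x, W τ x = 0 :=
  AxiallyPeriodicLiouville.eq_zero_of_isTypeIAncientMild_of_isAxiallyPeriodic hW hℓ hper

end Summit.NavierStokesRegularity.NavierStokesRegularity.Theorems.NearExtremalTransiencePerFlow.FilamentSelection

end
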